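import Summits.FinalStateConjecture.FinalStateConjecture.Theorems.EIHFluxBalanceInertialRecessionSlavingFarFieldSpinSmooth
import Summits.FinalStateConjecture.FinalStateConjecture.Theorems.EIHFluxBalanceInertialRecessionSlavingFarFieldSpinAtom

/-!
# Route EIHFluxBalance — `InertialRecession` (E′), K1 / stub `stub_coerMomKernel` (Bk), far field, part F3d:
# the flat momentum rows of the spin first-variation field are `M` times those of the scalar Lense–Thirring form

Helper file for the crux `stmt-FinalStateConjecture-17403` (last glue between Bk's objects and the spin-row tables /
`farField_translationSpin_eq_zero`): for ANY Lorentz element `L`, rotation generator `R = R_ω` and lab point `x` whose rest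
image is off the time axis, the CLM-valued spin first-variation field
`T z = (∂_{R y}σ_M)(y)(L⁻¹·,L⁻¹·) + σ_M(y)(RL⁻¹·,L⁻¹·) + σ_M(y)(L⁻¹·,RL⁻¹·)`, `y = L⁻¹z`, `σ_M = Kerr.spinMetric M`, satisfies
`fderiv T x w a b = M · fderiv (z ↦ S z a b) x w` with `S` the scalar Lense–Thirring closed form of spin `(−ω₂, ω₁, 0)`
(`fderiv_spinVar_eq_mul`); the row sums `Σᵢ(∂ᵢT_ij − ∂_jT_ii)` follow by `Finset.mul_sum`. No definitions,
no `sorry`. [folklore]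
-/

set_option linter.dupNamespace false
-- instance search through the nested operator types (as in the skeleton / `ChartCurvature`)
set_option maxSynthPendingDepth 6
set_option synthInstance.maxHeartbeats 200000

noncomputable section

open scoped Topology InnerProductSpace
open Filter Set Function Literature.Geometry.Lorentzian Literature.Geometry.Lorentzian.Schwarzschild

namespace Summit.FinalStateConjecture.FinalStateConjecture.Theorems.SublinearIsFree.Slaving

/-- **Componentwise: the derivative of the spin first-variation field is `M` times the derivative of the scalar
Lense–Thirring form** (spin vector `(−ω₂, ω₁, 0)`), at every lab point whose rest image is off the time axis. [folklore] -/
theorem fderiv_spinVar_eq_mul (M : ℝ) (L : lorentzGroup) (ω₁ ω₂ ω₃ : ℝ) (R : E4 →L[ℝ] E4)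
    (hR : ∀ u : E4, R u = ![0, ω₂ * u 3 - ω₃ * u 2, ω₃ * u 1 - ω₁ * u 3, ω₁ * u 2 - ω₂ * u 1])
    {x : E4} (hx : 0 < Kerr.radius 0 (poincareInv L 0 x)) (w a b : E4) :
    fderiv ℝ (fun z : E4 ↦ (fderiv ℝ (Kerr.spinMetric M) (poincareInv L 0 z) (R (poincareInv L 0 z) + 0)).bilinearComp
          (((L : E4 ≃L[ℝ] E4).symm : E4 →L[ℝ] E4)) (((L : E4 ≃L[ℝ] E4).symm : E4 →L[ℝ] E4)) +
        (Kerr.spinMetric M (poincareInv L 0 z)).bilinearComp (R.comp (((L : E4 ≃L[ℝ] E4).symm : E4 →L[ℝ] E4)))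
          (((L : E4 ≃L[ℝ] E4).symm : E4 →L[ℝ] E4)) +
        (Kerr.spinMetric M (poincareInv L 0 z)).bilinearComp (((L : E4 ≃L[ℝ] E4).symm : E4 →L[ℝ] E4))
          (R.comp (((L : E4 ≃L[ℝ] E4).symm : E4 →L[ℝ] E4)))) x w a b =
      M * fderiv ℝ (fun z : E4 ↦ 2 / E4.spatialNorm ((L : E4 ≃L[ℝ] E4).symm z) ^ 3 *
        (ell ((L : E4 ≃L[ℝ] E4).symm z) ((L : E4 ≃L[ℝ] E4).symm a) *
            sdot ((L : E4 ≃L[ℝ] E4).symm z) (WithLp.toLp 2 ![(0 : ℝ), ω₁ * ((L : E4 ≃L[ℝ] E4).symm b) 3 - 0 * ((L : E4 ≃L[ℝ] E4).symm b) 2,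
              0 * ((L : E4 ≃L[ℝ] E4).symm b) 1 - -ω₂ * ((L : E4 ≃L[ℝ] E4).symm b) 3,
              -ω₂ * ((L : E4 ≃L[ℝ] E4).symm b) 2 - ω₁ * ((L : E4 ≃L[ℝ] E4).symm b) 1]) +
          sdot ((L : E4 ≃L[ℝ] E4).symm z) (WithLp.toLp 2 ![(0 : ℝ), ω₁ * ((L : E4 ≃L[ℝ] E4).symm a) 3 - 0 * ((L : E4 ≃L[ℝ] E4).symm a) 2,
              0 * ((L : E4 ≃L[ℝ] E4).symm a) 1 - -ω₂ * ((L : E4 ≃L[ℝ] E4).symm a) 3,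
              -ω₂ * ((L : E4 ≃L[ℝ] E4).symm a) 2 - ω₁ * ((L : E4 ≃L[ℝ] E4).symm a) 1]) *
            ell ((L : E4 ≃L[ℝ] E4).symm z) ((L : E4 ≃L[ℝ] E4).symm b))) x w := by
  have hp : ∀ z : E4, poincareInv L 0 z = (((L : E4 ≃L[ℝ] E4).symm : E4 →L[ℝ] E4)) z := fun z ↦ by
    rw [poincareInv_zero]; rfl
  have hx' : 0 < Kerr.radius 0 ((((L : E4 ≃L[ℝ] E4).symm : E4 →L[ℝ] E4)) x) := by rwa [← hp]
  have hsp : E4.spatial ((((L : E4 ≃L[ℝ] E4).symm : E4 →L[ℝ] E4)) x) ≠ 0 := by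
    rw [Kerr.radius_zero_left, E4.spatialNorm] at hx'; exact norm_pos_iff.1 hx'
  simp only [hp]
  -- differentiability of the spin first-variation field
  have hdV := differentiableAt_spinVar M (((L : E4 ≃L[ℝ] E4).symm : E4 →L[ℝ] E4)) R 0 hx'
  rw [← OpensChart.fderiv_apply₂ _ hdV a b w]
  -- pointwise value near `x`
  have ho : IsOpen {z : E4 | 0 < Kerr.radius 0 ((((L : E4 ≃L[ℝ] E4).symm : E4 →L[ℝ] E4)) z)} :=
    isOpen_lt continuous_const ((Kerr.continuous_radius 0).comp (((L : E4 ≃L[ℝ] E4).symm : E4 →L[ℝ] E4)).continuous)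
  have hev : (fun z : E4 ↦ ((fderiv ℝ (Kerr.spinMetric M) ((((L : E4 ≃L[ℝ] E4).symm : E4 →L[ℝ] E4)) z)
        (R ((((L : E4 ≃L[ℝ] E4).symm : E4 →L[ℝ] E4)) z) + 0)).bilinearComp (((L : E4 ≃L[ℝ] E4).symm : E4 →L[ℝ] E4))
          (((L : E4 ≃L[ℝ] E4).symm : E4 →L[ℝ] E4)) +
        (Kerr.spinMetric M ((((L : E4 ≃L[ℝ] E4).symm : E4 →L[ℝ] E4)) z)).bilinearComp
          (R.comp (((L : E4 ≃L[ℝ] E4).symm : E4 →L[ℝ] E4))) (((L : E4 ≃L[ℝ] E4).symm : E4 →L[ℝ] E4)) +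
        (Kerr.spinMetric M ((((L : E4 ≃L[ℝ] E4).symm : E4 →L[ℝ] E4)) z)).bilinearComp
          (((L : E4 ≃L[ℝ] E4).symm : E4 →L[ℝ] E4)) (R.comp (((L : E4 ≃L[ℝ] E4).symm : E4 →L[ℝ] E4)))) a b) =ᶠ[𝓝 x]
      fun z : E4 ↦ M * (2 / E4.spatialNorm ((L : E4 ≃L[ℝ] E4).symm z) ^ 3 *
        (ell ((L : E4 ≃L[ℝ] E4).symm z) ((L : E4 ≃L[ℝ] E4).symm a) *
            sdot ((L : E4 ≃L[ℝ] E4).symm z) (WithLp.toLp 2 ![(0 : ℝ), ω₁ * ((L : E4 ≃L[ℝ] E4).symm b) 3 - 0 * ((L : E4 ≃L[ℝ] E4).symm b) 2,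
              0 * ((L : E4 ≃L[ℝ] E4).symm b) 1 - -ω₂ * ((L : E4 ≃L[ℝ] E4).symm b) 3,
              -ω₂ * ((L : E4 ≃L[ℝ] E4).symm b) 2 - ω₁ * ((L : E4 ≃L[ℝ] E4).symm b) 1]) +
          sdot ((L : E4 ≃L[ℝ] E4).symm z) (WithLp.toLp 2 ![(0 : ℝ), ω₁ * ((L : E4 ≃L[ℝ] E4).symm a) 3 - 0 * ((L : E4 ≃L[ℝ] E4).symm a) 2,
              0 * ((L : E4 ≃L[ℝ] E4).symm a) 1 - -ω₂ * ((L : E4 ≃L[ℝ] E4).symm a) 3,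
              -ω₂ * ((L : E4 ≃L[ℝ] E4).symm a) 2 - ω₁ * ((L : E4 ≃L[ℝ] E4).symm a) 1]) *
            ell ((L : E4 ≃L[ℝ] E4).symm z) ((L : E4 ≃L[ℝ] E4).symm b))) := by
    filter_upwards [ho.mem_nhds hx'] with z hz
    rw [spinVar_apply_eq M (((L : E4 ≃L[ℝ] E4).symm : E4 →L[ℝ] E4)) R ω₁ ω₂ ω₃ hR hz a b]
    simp only [ContinuousLinearEquiv.coe_coe]
    ring
  rw [hev.fderiv_eq]
  -- differentiability of the scalar Lense–Thirring form (the atom composed with `L⁻¹`)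
  have hat := hasFDerivAt_ltAtom hsp ((L : E4 ≃L[ℝ] E4).symm a) ((L : E4 ≃L[ℝ] E4).symm b)
    (WithLp.toLp 2 ![(0 : ℝ), ω₁ * ((L : E4 ≃L[ℝ] E4).symm a) 3 - 0 * ((L : E4 ≃L[ℝ] E4).symm a) 2,
      0 * ((L : E4 ≃L[ℝ] E4).symm a) 1 - -ω₂ * ((L : E4 ≃L[ℝ] E4).symm a) 3,
      -ω₂ * ((L : E4 ≃L[ℝ] E4).symm a) 2 - ω₁ * ((L : E4 ≃L[ℝ] E4).symm a) 1])
    (WithLp.toLp 2 ![(0 : ℝ), ω₁ * ((L : E4 ≃L[ℝ] E4).symm b) 3 - 0 * ((L : E4 ≃L[ℝ] E4).symm b) 2,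
      0 * ((L : E4 ≃L[ℝ] E4).symm b) 1 - -ω₂ * ((L : E4 ≃L[ℝ] E4).symm b) 3,
      -ω₂ * ((L : E4 ≃L[ℝ] E4).symm b) 2 - ω₁ * ((L : E4 ≃L[ℝ] E4).symm b) 1])
  have hdS : DifferentiableAt ℝ (fun z : E4 ↦ 2 / E4.spatialNorm ((L : E4 ≃L[ℝ] E4).symm z) ^ 3 *
        (ell ((L : E4 ≃L[ℝ] E4).symm z) ((L : E4 ≃L[ℝ] E4).symm a) *
            sdot ((L : E4 ≃L[ℝ] E4).symm z) (WithLp.toLp 2 ![(0 : ℝ), ω₁ * ((L : E4 ≃L[ℝ] E4).symm b) 3 - 0 * ((L : E4 ≃L[ℝ] E4).symm b) 2,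
              0 * ((L : E4 ≃L[ℝ] E4).symm b) 1 - -ω₂ * ((L : E4 ≃L[ℝ] E4).symm b) 3,
              -ω₂ * ((L : E4 ≃L[ℝ] E4).symm b) 2 - ω₁ * ((L : E4 ≃L[ℝ] E4).symm b) 1]) +
          sdot ((L : E4 ≃L[ℝ] E4).symm z) (WithLp.toLp 2 ![(0 : ℝ), ω₁ * ((L : E4 ≃L[ℝ] E4).symm a) 3 - 0 * ((L : E4 ≃L[ℝ] E4).symm a) 2,
              0 * ((L : E4 ≃L[ℝ] E4).symm a) 1 - -ω₂ * ((L : E4 ≃L[ℝ] E4).symm a) 3,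
              -ω₂ * ((L : E4 ≃L[ℝ] E4).symm a) 2 - ω₁ * ((L : E4 ≃L[ℝ] E4).symm a) 1]) *
            ell ((L : E4 ≃L[ℝ] E4).symm z) ((L : E4 ≃L[ℝ] E4).symm b))) x :=
    (hat.comp x (((L : E4 ≃L[ℝ] E4).symm : E4 →L[ℝ] E4)).hasFDerivAt).differentiableAt
  rw [fderiv_const_mul hdS]
  rfl

/-- Registered carrier `slaving_farFieldSpinVarRows_slaving12` of the crux item (= `fderiv_spinVar_eq_mul`). [folklore] -/
theorem slaving_farFieldSpinVarRows_slaving12 : open Literature.Geometry.Lorentzian Literature.Geometry.Lorentzian.Schwarzschild in ∀ (M : ℝ) (L : lorentzGroup) (ω₁ ω₂ ω₃ : ℝ) (R : E4 →L[ℝ] E4) (hR : ∀ u : E4, R u = ![0, ω₂ * u 3 - ω₃ * u 2, ω₃ * u 1 - ω₁ * u 3, ω₁ * u 2 - ω₂ * u 1]) {x : E4} (hx : 0 < Kerr.radius 0 (poincareInv L 0 x)) (w a b : E4), fderiv ℝ (fun z : E4 ↦ (fderiv ℝ (Kerr.spinMetric M) (poincareInv L 0 z) (R (poincareInv L 0 z)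 + 0)).bilinearComp (((L : E4 ≃L[ℝ] E4).symm : E4 →L[ℝ] E4)) (((L : E4 ≃L[ℝ] E4).symm : E4 →L[ℝ] E4)) + (Kerr.spinMetric M (poincareInv L 0 z)).bilinearComp (R.comp (((L : E4 ≃L[ℝ] E4).symm : E4 →L[ℝ] E4))) (((L : E4 ≃L[ℝ] E4).symm : E4 →L[ℝ] E4)) + (Kerr.spinMetric M (poincareInv L 0 z)).bilinearComp (((L : E4 ≃L[ℝ] E4).symm : E4 →L[ℝ] E4)) (R.comp (((L : E4 ≃L[ℝ] E4).symm : E4 →L[ℝ] E4)))) x w a b = M * fderiv ℝ (fun z : E4 ↦ 2 / E4.spatialNorm ((L : E4 ≃L[ℝ] E4).symm z) ^ 3 * (ell ((L : E4 ≃L[ℝ] E4).symm z) ((L : E4 ≃L[ℝ] E4).symm a) * sdot ((L : E4 ≃L[ℝ] E4).symm z) (WithLp.toLp 2 ![(0 : ℝ), ω₁ * ((L : E4 ≃L[ℝ] E4).symm b) 3 - 0 * ((L : E4 ≃L[ℝ] E4).symm b) 2, 0 * ((L : E4 ≃L[ℝ] E4).symm b) 1 - -ω₂ * ((L : E4 ≃L[ℝ]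 E4).symm b) 3, -ω₂ * ((L : E4 ≃L[ℝ] E4).symm b) 2 - ω₁ * ((L : E4 ≃L[ℝ] E4).symm b) 1]) + sdot ((L : E4 ≃L[ℝ] E4).symm z) (WithLp.toLp 2 ![(0 : ℝ), ω₁ * ((L : E4 ≃L[ℝ] E4).symm a) 3 - 0 * ((L : E4 ≃L[ℝ] E4).symm a) 2, 0 * ((L : E4 ≃L[ℝ] E4).symm a) 1 - -ω₂ * ((L : E4 ≃L[ℝ] E4).symm a) 3, -ω₂ * ((L : E4 ≃L[ℝ] E4).symm a) 2 - ω₁ * ((L : E4 ≃L[ℝ] E4).symm a) 1]) * ell ((L : E4 ≃L[ℝ] E4).symm z) ((L : E4 ≃L[ℝ] E4).symm b))) x w :=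
  fderiv_spinVar_eq_mul

end Summit.FinalStateConjecture.FinalStateConjecture.Theorems.SublinearIsFree.Slaving
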